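import Literature.NumberTheory.Automorphic.UnboundedDenominatorsRationalityProofs
import Literature.NumberTheory.Automorphic.UnboundedDenominatorsCor453Reduction
import Literature.GroupTheory.ArithmeticGroups.IharaAmalgamCongruenceKernel
import Mathlib.GroupTheory.Commutator.Basic
import HarnessLib

/-!
# The unbounded denominators theorem (Calegari–Dimitrov–Tang) — Theorem 1.0.1 from ONE printed input: Corollary 4.5.3

PROOF-ONLY file (no definition, no named fact; D-0026).  With Ihara's amalgam and the congruence subgroup
property of `SL₂(ℤ[1/p])` both theorems of the tree
(`Literature.GroupTheory.ArithmeticGroups.IharaAmalgam.exists_level_of_intertwined`, files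
`IharaAmalgam{PingPong,Lift,Generation,CongruenceKernel}.lean`), the hypothesis `hker₂` of
`CalegariDimitrovTang2025_unboundedDenominators.of_two_inputs` is discharged, and the named fact
`CalegariDimitrovTang2025_unboundedDenominators` (CDT, J. AMS 38 (2025), Thm. 1.0.1) follows from ONE remaining
printed input, CDT Corollary 4.5.3 (of the cohomological Theorem 4.5.2, `H̃¹(𝐅_ℓ)^{SL₂(ℤ̂)} = 0`), in any of
three equivalent shapes:

* `…of_cor453` — Cor. 4.5.3 as printed ("if every `g η - η` is congruence then `η` is congruence", finite
  abelian coefficients);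
* `…of_cor453_invariant` — the INVARIANT form (an `SL₂(ℤ)`-conjugation-invariant homomorphism
  `Γ(N) → Q`, `Q` finite abelian, is trivial on some `Γ(M)`), via the tree's `cor453_of_invariant_form`;
* `…of_commutator_congruence` — the purely group-theoretic form «for every `N ≥ 1` the commutator subgroup
  `[SL₂(ℤ), Γ(N)]` contains `Γ(M) ∩ Γ(N)` for some `M ≠ 0`» (by Hopf's formula with `H₂(SL₂(ℤ)) = 0` this is a
  statement about the Schur multiplier `H₂(SL₂(ℤ/N), ℤ)`; Beyl, Math. Z. 191 (1986)).

Everything else of CDT (Prop. 3.0.1, Thm. 5.1.4, Rem. 3.0.2, §§4.1–4.4, 4.6, (4.3.3), `hrat`, §6.3) is kernel-checked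
in the sibling files.  Consumers: the BSD crux K★ (`StarredOptimalManinUnitFiveSeven`, via
`…EdixhovenFibreFiveSevenOfCDTInt`) and `Summit.Langlands…IntegralOverconvergentIsCongruence`.

## References

* [CalegariDimitrovTang2025] F. Calegari, V. Dimitrov, Y. Tang, The unbounded denominators conjecture,
  J. Amer. Math. Soc. 38 (2025), Thm. 1.0.1, Thm. 4.5.2, Cor. 4.5.3, Lemma 4.6.2.
-/

set_option autoImplicit false

noncomputable section

open scoped MatrixGroups
open CongruenceSubgroup Matrix.SpecialLinearGroup

namespace Literature.NumberTheory.Automorphic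

namespace UnboundedDenominators

/-! ### Invariant homomorphisms kill `[SL₂(ℤ), Γ(N)]` (reduction to the commutator form) -/

/-- An `SL₂(ℤ)`-conjugation-invariant homomorphism `θ : Γ(N) → Q` is trivial on the commutator
subgroup `[SL₂(ℤ), Γ(N)]` (which lies in `Γ(N)` by normality): `θ(g x g⁻¹ x⁻¹) = θ(g x g⁻¹) θ(x)⁻¹ = 1`.
[folklore] -/
private theorem apply_eq_one_of_mem_commutator' {N : ℕ} {Q : Type*} [Group Q] (θ : Gamma N →* Q)
    (hθ : ∀ (g x : SL(2, ℤ)) (hx : x ∈ Gamma N) (hgx : g * x * g⁻¹ ∈ Gamma N),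
      θ ⟨g * x * g⁻¹, hgx⟩ = θ ⟨x, hx⟩)
    {x : SL(2, ℤ)} (hxC : x ∈ ⁅(⊤ : Subgroup SL(2, ℤ)), Gamma N⁆) (hx : x ∈ Gamma N) :
    θ ⟨x, hx⟩ = 1 := by
  -- closure induction over the generating commutators
  have key : ∀ y ∈ ⁅(⊤ : Subgroup SL(2, ℤ)), Gamma N⁆, ∀ hy : y ∈ Gamma N, θ ⟨y, hy⟩ = 1 := by
    intro y hy
    rw [Subgroup.commutator_def] at hy
    refine Subgroup.closure_induction (p := fun y _ ↦ ∀ hy : y ∈ Gamma N, θ ⟨y, hy⟩ = 1)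
      ?_ ?_ ?_ ?_ hy
    · rintro _ ⟨g, -, z, hz, rfl⟩
      have hgz : g * z * g⁻¹ ∈ Gamma N := (Gamma_normal N).conj_mem z hz g
      change ∀ hmem' : g * z * g⁻¹ * z⁻¹ ∈ Gamma N, θ ⟨g * z * g⁻¹ * z⁻¹, hmem'⟩ = 1 at *
      intro hmem'
      have : (⟨g * z * g⁻¹ * z⁻¹, hmem'⟩ : Gamma N) = ⟨g * z * g⁻¹, hgz⟩ * ⟨z, hz⟩⁻¹ := rfl
      rw [this, map_mul, map_inv, hθ g z hz hgz, mul_inv_cancel]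
    · intro h1
      have : (⟨1, h1⟩ : Gamma N) = 1 := rfl
      rw [this, map_one]
    · intro a b ha hb iha ihb hab
      haveI := Gamma_normal N
      have ha' : a ∈ Gamma N := by
        rw [← Subgroup.commutator_def] at ha; exact Subgroup.commutator_le_right _ _ ha
      have hb' : b ∈ Gamma N := by
        rw [← Subgroup.commutator_def] at hb; exact Subgroup.commutator_le_right _ _ hb
      have : (⟨a * b, hab⟩ : Gamma N) = ⟨a, ha'⟩ * ⟨b, hb'⟩ := rfl
      rw [this, map_mul, iha ha', ihb hb', one_mul]
    · intro a ha iha hainv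
      haveI := Gamma_normal N
      have ha' : a ∈ Gamma N := by
        rw [← Subgroup.commutator_def] at ha; exact Subgroup.commutator_le_right _ _ ha
      have : (⟨a⁻¹, hainv⟩ : Gamma N) = ⟨a, ha'⟩⁻¹ := rfl
      rw [this, map_inv, iha ha', inv_one]
  exact key x hxC hx

/-- **Reduction of `stub_hcor_invariant` to a statement about `SL₂(ℤ)` alone.** If for every level
`N ≥ 1` the commutator subgroup `[SL₂(ℤ), Γ(N)]` contains `Γ(M) ∩ Γ(N)` for some `M ≠ 0` (i.e. is a
congruence subgroup), then every `SL₂(ℤ)`-invariant homomorphism `Γ(N) → Q` is trivial on some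
`Γ(M)` — verbatim the registered stub `stub_hcor_invariant` of the line `cdt_thm1` (CDT Cor. 4.5.3 in
invariant form). [folklore] -/
private theorem hcor_invariant_of_commutator_congruence'
    (h : ∀ N : ℕ, 0 < N → ∃ M : ℕ, M ≠ 0 ∧ Gamma M ⊓ Gamma N ≤ ⁅(⊤ : Subgroup SL(2, ℤ)), Gamma N⁆) :
    ∀ (N : ℕ) (Q : Type) [CommGroup Q] [Finite Q] (θ : Gamma N →* Q),
      (∀ (g x : SL(2, ℤ)) (hx : x ∈ Gamma N) (hgx : g * x * g⁻¹ ∈ Gamma N),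
        θ ⟨g * x * g⁻¹, hgx⟩ = θ ⟨x, hx⟩) →
      ∃ M : ℕ, M ≠ 0 ∧ ∀ (x : SL(2, ℤ)) (hx : x ∈ Gamma N), x ∈ Gamma M → θ ⟨x, hx⟩ = 1 := by
  intro N Q _ _ θ hθ
  rcases Nat.eq_zero_or_pos N with rfl | hN
  · refine ⟨1, one_ne_zero, fun x hx _ ↦ ?_⟩
    have hx1 : x = 1 := by simpa [Gamma_zero_bot] using hx
    subst hx1
    have : (⟨1, hx⟩ : Gamma 0) = 1 := rfl
    rw [this, map_one]
  · obtain ⟨M, hM, hle⟩ := h N hN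
    exact ⟨M, hM, fun x hx hxM ↦ apply_eq_one_of_mem_commutator' θ hθ (hle ⟨hxM, hx⟩) hx⟩


end UnboundedDenominators

open UnboundedDenominators

/-- **CDT Theorem 1.0.1 from Corollary 4.5.3 alone** (as printed: for `θ : Γ(N) → Q`, `Q` finite abelian, if every
`x ↦ θ(g x g⁻¹) θ(x)⁻¹` has congruence kernel then so has `θ`).  The other input `hker₂` of `of_two_inputs`
(amalgam + CSP, Lemma 4.6.2) is the tree theorem `IharaAmalgam.exists_level_of_intertwined`.
[cite: CalegariDimitrovTang2025, Thm. 1.0.1 and Cor. 4.5.3] -/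
theorem _root_.Literature.NumberTheory.Automorphic.CalegariDimitrovTang2025_unboundedDenominators.of_cor453
    (hcor : ∀ (N : ℕ) (Q : Type) [CommGroup Q] [Finite Q] (θ : Gamma N →* Q),
      (∀ g : SL(2, ℤ), ∃ M : ℕ, M ≠ 0 ∧ ∀ (x : SL(2, ℤ)) (hx : x ∈ Gamma N)
        (hgx : g * x * g⁻¹ ∈ Gamma N), x ∈ Gamma M → θ ⟨g * x * g⁻¹, hgx⟩ = θ ⟨x, hx⟩) →
      ∃ M : ℕ, M ≠ 0 ∧ ∀ (x : SL(2, ℤ)) (hx : x ∈ Gamma N), x ∈ Gamma M → θ ⟨x, hx⟩ = 1) :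
    CalegariDimitrovTang2025_unboundedDenominators :=
  CalegariDimitrovTang2025_unboundedDenominators.of_two_inputs
    Literature.GroupTheory.ArithmeticGroups.IharaAmalgam.exists_level_of_intertwined hcor

/-- **CDT Theorem 1.0.1 from Corollary 4.5.3 in invariant form** (an `SL₂(ℤ)`-conjugation-invariant
homomorphism `Γ(N) → Q`, `Q` finite abelian, is trivial on some `Γ(M)`).
[cite: CalegariDimitrovTang2025, Thm. 1.0.1, Thm. 4.5.2 and Cor. 4.5.3] -/
theorem _root_.Literature.NumberTheory.Automorphic.CalegariDimitrovTang2025_unboundedDenominators.of_cor453_invariant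
    (hinv : ∀ (N : ℕ) (Q : Type) [CommGroup Q] [Finite Q] (θ : Gamma N →* Q),
      (∀ (g x : SL(2, ℤ)) (hx : x ∈ Gamma N) (hgx : g * x * g⁻¹ ∈ Gamma N),
        θ ⟨g * x * g⁻¹, hgx⟩ = θ ⟨x, hx⟩) →
      ∃ M : ℕ, M ≠ 0 ∧ ∀ (x : SL(2, ℤ)) (hx : x ∈ Gamma N), x ∈ Gamma M → θ ⟨x, hx⟩ = 1) :
    CalegariDimitrovTang2025_unboundedDenominators :=
  CalegariDimitrovTang2025_unboundedDenominators.of_cor453 (cor453_of_invariant_form hinv)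

/-- **CDT Theorem 1.0.1 from «`[SL₂(ℤ), Γ(N)]` is a congruence subgroup for every `N`»** — the purely
group-theoretic residue of CDT §4.5 (equivalently: the Schur-multiplier classes `H₂(SL₂(ℤ/N), ℤ)` die on some
`Γ(M)`; Beyl 1986). [cite: CalegariDimitrovTang2025, Thm. 1.0.1 and Thm. 4.5.2] -/
theorem _root_.Literature.NumberTheory.Automorphic.CalegariDimitrovTang2025_unboundedDenominators.of_commutator_congruence
    (h : ∀ N : ℕ, 0 < N → ∃ M : ℕ, M ≠ 0 ∧ Gamma M ⊓ Gamma N ≤ ⁅(⊤ : Subgroup SL(2, ℤ)), Gamma N⁆) :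
    CalegariDimitrovTang2025_unboundedDenominators :=
  CalegariDimitrovTang2025_unboundedDenominators.of_cor453_invariant
    (hcor_invariant_of_commutator_congruence' h)

end Literature.NumberTheory.Automorphic

end
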